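/-
Copyright (c) 2026 the pub-hodgecm-mathlib formalisation cell (harness21).  Prover seat hodgecm-mathlib-K2E1-p16 (g4), Track B ∕ K2-LIT, h413 = `stmt-HodgeConjecture-24833`,
R90-TF section S8 «ContSpec-n½», socket (E) :276 (N₃) row, S8 dealer R90-CS-plan (g3) S8-R248 (3): the CHARACTER-ESTATE letters `χK e hχmul hχone hχinv he0 he1 heK hestar` of the E1
block estate (★ `resG_isotypic_le_orthogonal_lines` ∕ ★ `hNblk_of_record` ∕ ★ `res_exhaustion_le_closure_of_record`; and `hχconv hχinv` on the χ_τ road ★ `…_of_conv`) DISCHARGED as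
∃-packages from the ★ p864952 idempotent model and the ★ level idempotent; census `K2/K2E1-p16/g4/CENSUS-CharacterEstateOfTauModel.md`.
-/
import Summits.HodgeConjecture.HodgeConjecture.Theorems.R90S8ResGIsotypicTauIdempotentModelU3   -- ★ p864952 (this seat): `exists_compactlySupported_tauIdem`, `tauIdem_mulConv`, `tauIdem_conj_inv`
import Summits.HodgeConjecture.HodgeConjecture.Theorems.R90S8LevelIdempotentOfCompactOpenU        -- ★ p86374x (K2E1-p14 (g4)): `exists_levelIdempotent`, `exists_levelIdempotent_of_record`
import HarnessLib

/-!
# R90-TF · S8 «ContSpec-n½» — `R90S8ResGBlockCharacterEstateOfTauModelU3`: THE CHARACTER-ESTATE LETTERS `χK e hχmul hχone hχinv he0 he1 heK hestar` OF THE E1 BLOCK ESTATE, INHABITED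
# (one-dimensional types: the letters VERBATIM; `K_∞`-types of any dimension: the χ_τ-road twins `hχconv hχinv`)

Cell `hodgecm-mathlib`, crux H413 (`stmt-HodgeConjecture-24833`, lane `--supports … --as helper`), route of record `HCCMUnconditional`; R90-TF section S8, socket (E) `sock_S8_res_exhaustion_le_closure`
(B ED. 7 :276) via ★ `res_exhaustion_le_closure_of_record`, whose E1-estate bill carries, PER BLOCK, the character-estate letters: a `K_∞`-type kernel `χK : C_c(K, ℂ)` with `hχmul : χK(kl) =
χK(k)χK(l)`, `hχone : χK(1) = 1`, `hχinv : conj χK(k⁻¹) = χK(k)` (★ `resG_isotypic_le_orthogonal_lines`, ★ `hNblk_of_record`) — on the χ_τ road of ★ `R90S8ResGIsotypicTauLinesU3` the pair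
`hχconv : χK = χK ⋆ χK`, `hχinv` instead — and a level kernel `e : C_c(G_f, ℂ)` with `he0 he1 heK hestar`.  THEOREMS ONLY (no `def`, no `instance`, no `notation`, no named-fact hypothesis, no
`sorry`; default heartbeats); count-neutral; CLOSES NO SOCKET: it inhabits structural binders of a letter list, as ★ `exists_levelIdempotent_of_record` did for the `e`-rows alone.

THE MATHEMATICS ([BrockerTomDieck1985] II (4.10), (4.16), III (5.9)–(5.10); [DeitmarEchterhoff2014] Prop. 6.2.1, Prop. 7.3.3; [BorelJacquet1979] §4.1; [Knapp1986] VIII §3).  Two kinds of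
`K_∞`-type kernels inhabit the bill.  (i) A ONE-DIMENSIONAL type is a continuous unitary character `ψ : K →* ℂ` (`|ψ| = 1`); its kernel `χK := conj ψ` is continuous with compact support (the
group is compact), MULTIPLICATIVE, `χK(1) = 1`, and `conj χK(k⁻¹) = conj conj ψ(k)⁻¹ = ψ(k)⁻¹⁻¹… = conj ψ(k)` since `ψ(k)⁻¹ = conj ψ(k)` on the unit circle — the letters `hχmul hχone hχinv`
VERBATIM (§1 `exists_charKernel`).  (ii) A `K_∞`-type `τ` of ANY dimension (irreducible, unitary, continuous on a finite-dimensional `E`) has the χ_τ-idempotent kernel `χ_τ♮ := dim τ •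
conj χ_τ` (★ `exists_compactlySupported_tauIdem`), which is NOT multiplicative for `dim τ > 1` but is a CONVOLUTION IDEMPOTENT for the probability Haar measure (★ `tauIdem_mulConv`, II
(4.16)(iii)) and `*`-symmetric (★ `tauIdem_conj_inv`) — the letters `hχconv hχinv` of the χ_τ road (§1 `exists_tauKernel`); for `dim τ = 1` the two kernels agree (`χ_τ = ψ`, §1
`tauKernel_apply_of_finrank_eq_one`).  (iii) The level kernel `e = ν_f(K′_f)⁻¹ 𝟙_{K′_f}` inhabits `he0 he1 heK hestar` for every compact-open `K′_f` (★ `exists_levelIdempotent`).  §2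
packages (i)∕(ii) with (iii) at the index of record of `U(J₃)_{L∕L⁺}` in the ORDER the estate consumers bind them, so the next «of record» editions `obtain` the whole character estate
in one line: **`exists_characterEstate_of_character`** (letters `χK e hχmul hχone hχinv he0 he1 heK hestar` VERBATIM) and **`exists_characterEstate_of_tau`** (`χK e`, χ_τ♮-formula,
`hχconv hχinv he0 he1 heK hestar`).
NOT DISCHARGED HERE (honest): the projector∕model letters `P hPdef hT𝓐 hTP hTB U s hs hU hline hScP hUker` of the same bill (F0P2-p10 (g4)'s (4) and the E1 Plancherel estate proper);
`hχmul` for `dim τ > 1` is FALSE and is REPLACED (★ FILE B `R90S8ResGIsotypicTauLinesU3`), not discharged.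
HONEST LABEL: HC_CM is proved only modulo the 7 printed citations (2 remaining named inputs: hLiu418 = `stmt-HodgeConjecture-24832`, h413 = `stmt-HodgeConjecture-24833`) until rung 0
closes; REL ≠ ★ ≠ BUILT; this file asserts no named fact and closes no socket; count-neutral; unconditional.

## References
* [BrockerTomDieck1985] T. Bröcker, T. tom Dieck, *Representations of Compact Lie Groups*, GTM 98 (1985), II (4.10), (4.16), III (5.9)–(5.10).
* [DeitmarEchterhoff2014] A. Deitmar, S. Echterhoff, *Principles of Harmonic Analysis* (2nd ed., 2014), Prop. 6.2.1, Prop. 7.3.3.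
* [BorelJacquet1979] A. Borel, H. Jacquet, *Automorphic forms and automorphic representations*, PSPM 33.1 (1979), §4.1 (idempotents `e_{K′}`), §4.6.
* [Knapp1986] A. W. Knapp, *Representation Theory of Semisimple Groups* (1986), VIII §3 (`E_τ = d_τ ∫_K conj χ_τ(k) π(k) dk`).
-/

set_option autoImplicit false
set_option linter.dupNamespace false  -- the mandated namespace `…HodgeConjecture.HodgeConjecture.R90.S8` (LEAD #1 L1) repeats the summit's segment

noncomputable section

open MeasureTheory Filter Topology CompactlySupported NumberField ContRepresentation Set
open scoped InnerProductSpace ENNReal ComplexConjugate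
open Literature.NumberTheory.Automorphic Literature.NumberTheory.Automorphic.UnitaryGroup AdelicGroupData
open Literature.RepresentationTheory.CompactGroups

namespace Summit.HodgeConjecture.HodgeConjecture.R90.S8

/-! ## §1 Generic compact `K`: the two `K`-type kernels `conj ψ` (one-dimensional type) and `χ_τ♮ = dim τ • conj χ_τ` (any dimension) with their letters -/

section Kernels

variable {K : Type*} [Group K] [TopologicalSpace K] [IsTopologicalGroup K] [MeasurableSpace K] [BorelSpace K] [CompactSpace K]
  {E : Type*} [NormedAddCommGroup E] [InnerProductSpace ℂ E] [FiniteDimensional ℂ E]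

omit [IsTopologicalGroup K] [MeasurableSpace K] [BorelSpace K] in
/-- **ONE-DIMENSIONAL TYPES: the kernel `χK := conj ψ` of a continuous unitary character `ψ` INHABITS `hχmul hχone hχinv` VERBATIM** — continuous with compact support on the compact group,
multiplicative, `χK 1 = 1`, and `conj χK(k⁻¹) = χK(k)` because `ψ(k)⁻¹ = conj ψ(k)` on the unit circle (Mathlib `Complex.inv_eq_conj`). [cite: BrockerTomDieck1985, II Prop (4.10)]
[cite: BorelJacquet1979, §4.6] -/
theorem exists_charKernel (ψ : K →* ℂ) (hψc : Continuous ψ) (hψ1 : ∀ k, ‖ψ k‖ = 1) :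
    ∃ χ : C_c(K, ℂ), (∀ k, χ k = conj (ψ k)) ∧ (∀ k l, χ (k * l) = χ k * χ l) ∧ χ 1 = 1 ∧ ∀ k, conj (χ k⁻¹) = χ k := by
  refine ⟨⟨⟨fun k => conj (ψ k), Complex.continuous_conj.comp hψc⟩, HasCompactSupport.of_compactSpace _⟩, fun _ => rfl, fun k l => ?_, ?_, fun k => ?_⟩
  · show conj (ψ (k * l)) = conj (ψ k) * conj (ψ l)
    rw [map_mul, map_mul]
  · show conj (ψ 1) = 1
    rw [map_one, map_one]
  · show conj (conj (ψ k⁻¹)) = conj (ψ k)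
    rw [Complex.conj_conj, map_inv, Complex.inv_eq_conj (hψ1 k)]

/-- **`K_∞`-TYPES OF ANY DIMENSION: the χ_τ-idempotent kernel `χ_τ♮ = dim τ • conj χ_τ` INHABITS the χ_τ-road letters `hχconv hχinv`** for an irreducible unitary continuous `τ` on a
finite-dimensional `E` and a left-invariant probability measure `μK` (★ `exists_compactlySupported_tauIdem`, ★ `tauIdem_mulConv` — II (4.16)(iii), ★ `tauIdem_conj_inv`).
[cite: BrockerTomDieck1985, II Prop (4.16)] [cite: DeitmarEchterhoff2014, Prop. 7.3.3] [cite: Knapp1986, VIII §3] -/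
theorem exists_tauKernel (μK : Measure K) [IsProbabilityMeasure μK] [μK.IsMulLeftInvariant] (τ : ContRepresentation ℂ K E) (hτc : Continuous (τ : K → E →L[ℂ] E))
    [τ.toRepresentation.IsIrreducible] (hτu : ∀ (k : K) (v w : E), ⟪τ k v, τ k w⟫_ℂ = ⟪v, w⟫_ℂ) :
    ∃ χ : C_c(K, ℂ), (∀ k, χ k = (Module.finrank ℂ E : ℂ) * conj (Schur.character τ k)) ∧ (∀ x, χ x = mulConv μK (⇑χ) (⇑χ) x) ∧ ∀ k, conj (χ k⁻¹) = χ k := by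
  obtain ⟨χ, hχ⟩ := exists_compactlySupported_tauIdem τ hτc
  exact ⟨χ, hχ, tauIdem_mulConv μK τ hτc hτu hχ, tauIdem_conj_inv τ hτu hχ⟩

omit [TopologicalSpace K] [IsTopologicalGroup K] [MeasurableSpace K] [BorelSpace K] [CompactSpace K] [FiniteDimensional ℂ E] in
/-- **For a ONE-DIMENSIONAL type the two kernels agree**: if `dim E = 1` then `χ_τ♮(k) = conj χ_τ(k)` (`dim τ • conj χ_τ = conj χ_τ`), so the χ_τ road specialises to the multiplicative
road at one-dimensional types. [cite: BrockerTomDieck1985, II Prop (4.10)] -/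
theorem tauKernel_apply_of_finrank_eq_one [TopologicalSpace K] (τ : ContRepresentation ℂ K E) (hE : Module.finrank ℂ E = 1) {χ : C_c(K, ℂ)}
    (hχτ : ∀ k, χ k = (Module.finrank ℂ E : ℂ) * conj (Schur.character τ k)) (k : K) : χ k = conj (Schur.character τ k) := by
  rw [hχτ, hE, Nat.cast_one, one_mul]

end Kernels

/-! ## §2 At `U(J₃)_{L∕L⁺}` and the index of record: the whole character estate `χK e` + letters in ONE `obtain` -/

section Record

variable (L : Type) [Field L] [NumberField L] [IsCMField L]
  [MeasurableSpace (finAdelic (↥(maximalRealSubfield L)) L (IsCMField.complexConj L) 3 ((StdForm.antidiagonal 3).over L))] [BorelSpace (finAdelic (↥(maximalRealSubfield L)) L (IsCMField.complexConj L) 3 ((StdForm.antidiagonal 3).over L))]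
  (νf : Measure (finAdelic (↥(maximalRealSubfield L)) L (IsCMField.complexConj L) 3 ((StdForm.antidiagonal 3).over L))) [IsFiniteMeasureOnCompacts νf] [νf.IsOpenPosMeasure]
  (Kf : {Kf : Subgroup ↥(finAdelic (↥(maximalRealSubfield L)) L (IsCMField.complexConj L) 3 ((StdForm.antidiagonal 3).over L)) // IsOpen ((Kf : Subgroup ↥(finAdelic (↥(maximalRealSubfield L)) L (IsCMField.complexConj L) 3 ((StdForm.antidiagonal 3).over L))) : Set ↥(finAdelic (↥(maximalRealSubfield L)) L (IsCMField.complexConj L) 3 ((StdForm.antidiagonal 3).over L))) ∧ Kf ≤ ((((standardMaximalCompactGL 3 L).comap (adelicVal (↥(maximalRealSubfield L)) L (IsCMField.complexConj L) 3 ((StdForm.antidiagonal 3).over L)) : Subgroup (quasiSplit (↥(maximalRealSubfield L)) L (IsCMField.complexConj L) 3).Adelic)).comap (finAdelicToAdelic (↥(maximalRealSubfield L)) L (IsCMField.complexConj L) 3 ((StdForm.antidiagonal 3).over L)) : Subgroup ↥(finAdelic (↥(maximalRealSubfield L)) L (IsCMField.complexConj L) 3 ((StdForm.antidiagonal 3).over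 L)))})
  {K : Type*} [Group K] [TopologicalSpace K] [IsTopologicalGroup K] [MeasurableSpace K] [BorelSpace K] [CompactSpace K]

omit [IsTopologicalGroup K] [MeasurableSpace K] [BorelSpace K] in
/-- **THE CHARACTER ESTATE OF A ONE-DIMENSIONAL TYPE, INHABITED**: for every compact `K` (E1: `K_∞`, or `K_∞ ∩ U(1⊗1)` through the κ of record), every continuous unitary character `ψ` of
`K`, every finite level of record `Kf` (open, `≤ K₀`) and every `ν_f` finite on compacta and positive on opens there are `χK : C_c(K, ℂ)` and `e : C_c(U(J₃)(𝔸_{L⁺,f}), ℂ)` with EXACTLY the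
letters `hχmul hχone hχinv he0 he1 heK hestar` of ★ `resG_isotypic_le_orthogonal_lines` ∕ ★ `hNblk_of_record` at `K′f := Kf.1` (and `χK = conj ψ`). [cite: BorelJacquet1979, §4.1, §4.6]
[cite: BrockerTomDieck1985, II Prop (4.10)] -/
theorem exists_characterEstate_of_character (ψ : K →* ℂ) (hψc : Continuous ψ) (hψ1 : ∀ k, ‖ψ k‖ = 1) :
    ∃ (χ : C_c(K, ℂ)) (e : C_c(finAdelic (↥(maximalRealSubfield L)) L (IsCMField.complexConj L) 3 ((StdForm.antidiagonal 3).over L), ℂ)),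
      (∀ k, χ k = conj (ψ k)) ∧ (∀ k l, χ (k * l) = χ k * χ l) ∧ χ 1 = 1 ∧ (∀ k, conj (χ k⁻¹) = χ k) ∧
      (∀ x : finAdelic (↥(maximalRealSubfield L)) L (IsCMField.complexConj L) 3 ((StdForm.antidiagonal 3).over L), x ∉ Kf.1 → e x = 0) ∧ ∫ x, e x ∂νf = 1 ∧
      (∀ k ∈ Kf.1, ∀ x, e (k * x) = e x) ∧ ∀ x : finAdelic (↥(maximalRealSubfield L)) L (IsCMField.complexConj L) 3 ((StdForm.antidiagonal 3).over L), mulStar (⇑e) x = e x := by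
  obtain ⟨χ, hχ, hmul, hone, hinv⟩ := exists_charKernel ψ hψc hψ1
  obtain ⟨e, he0, he1, heK, hestar⟩ := exists_levelIdempotent_of_record L νf Kf
  exact ⟨χ, e, hχ, hmul, hone, hinv, he0, he1, heK, hestar⟩

/-- **THE CHARACTER ESTATE OF A `K_∞`-TYPE OF ANY DIMENSION, INHABITED (χ_τ road)**: for every compact `K` with a left-invariant probability measure `μK`, every irreducible unitary continuous
finite-dimensional `τ`, every finite level of record `Kf` and every `ν_f` finite on compacta and positive on opens there are `χK : C_c(K, ℂ)` — the χ_τ-idempotent `dim τ • conj χ_τ` — and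
`e : C_c(U(J₃)(𝔸_{L⁺,f}), ℂ)` with EXACTLY the letters `hχconv hχinv he0 he1 heK hestar` of ★ `resG_isotypic_le_orthogonal_lines_of_conv` at `K′f := Kf.1`; the block projector of the
τ-cut block is then `P := R_K(χK) ∘L R_f(e)` (`hPdef := rfl`). [cite: BrockerTomDieck1985, II Prop (4.16)] [cite: BorelJacquet1979, §4.1] [cite: Knapp1986, VIII §3] -/
theorem exists_characterEstate_of_tau (μK : Measure K) [IsProbabilityMeasure μK] [μK.IsMulLeftInvariant]
    {E : Type*} [NormedAddCommGroup E] [InnerProductSpace ℂ E] [FiniteDimensional ℂ E] (τ : ContRepresentation ℂ K E) (hτc : Continuous (τ : K → E →L[ℂ] E))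
    [τ.toRepresentation.IsIrreducible] (hτu : ∀ (k : K) (v w : E), ⟪τ k v, τ k w⟫_ℂ = ⟪v, w⟫_ℂ) :
    ∃ (χ : C_c(K, ℂ)) (e : C_c(finAdelic (↥(maximalRealSubfield L)) L (IsCMField.complexConj L) 3 ((StdForm.antidiagonal 3).over L), ℂ)),
      (∀ k, χ k = (Module.finrank ℂ E : ℂ) * conj (Schur.character τ k)) ∧ (∀ x, χ x = mulConv μK (⇑χ) (⇑χ) x) ∧ (∀ k, conj (χ k⁻¹) = χ k) ∧
      (∀ x : finAdelic (↥(maximalRealSubfield L)) L (IsCMField.complexConj L) 3 ((StdForm.antidiagonal 3).over L), x ∉ Kf.1 → e x = 0) ∧ ∫ x, e x ∂νf = 1 ∧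
      (∀ k ∈ Kf.1, ∀ x, e (k * x) = e x) ∧ ∀ x : finAdelic (↥(maximalRealSubfield L)) L (IsCMField.complexConj L) 3 ((StdForm.antidiagonal 3).over L), mulStar (⇑e) x = e x := by
  obtain ⟨χ, hχ, hconv, hinv⟩ := exists_tauKernel μK τ hτc hτu
  obtain ⟨e, he0, he1, heK, hestar⟩ := exists_levelIdempotent_of_record L νf Kf
  exact ⟨χ, e, hχ, hconv, hinv, he0, he1, heK, hestar⟩

end Record

end Summit.HodgeConjecture.HodgeConjecture.R90.S8

end
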